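/-
Copyright: cell gate-hubbard-kl, typer seat t6 (D-0069 (2) B1 statement-typer wave). Proof file: discharges the named
fact `Lemma1Antiperiodisation` of `FermiRG/DR2000PartIModel.lean`; nothing here is a claim about the Hubbard model or
about superconductivity.
-/
import Mathlib
import Literature.MathematicalPhysics.QuantumLattice.FermiRG.DR2000PartIModel
import HarnessLib

/-!
# Disertori–Rivasseau 2000, Part I, Lemma 1 — PROVED: the finite-temperature kernel is the antiperiodisation of
# the zero-temperature one

M. Disertori, V. Rivasseau, *Interacting Fermi liquid in two dimensions at finite temperature. Part I: Convergent
Attributions*, Commun. Math. Phys. **215** (2000) 251–290, arXiv:cond-mat/9907130 [DisertoriRivasseau2000], §II.1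
Lemma 1 (II.9), render `paper:arxiv-cond-mat_9907130` p0003:L103–114 (LOCATOR = chunk:line of the corpus-TeX render):
«The function C defined in (II.4) can also be written as C(x) = f(x₀,x⃗) := Σ_{m∈ℤ} (−1)^m C₀(x₀ + m/T, x⃗) where C₀ is
the propagator at T = 0.  Proof: … we first prove that the function f is antiperiodic on 1/T. Since f̂(k) = Ĉ(k) ∀k,
the Lemma holds.»  This file discharges the named fact
`Literature.MathematicalPhysics.QuantumLattice.FermiRG.DR2000.Lemma1Antiperiodisation` (cell FACT-LIST F-039, DAG row
DR1.L1) of the DEFINITION-FROZEN statement file `FermiRG/DR2000PartIModel.lean` WITHOUT touching that file: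
`theorem Lemma1Antiperiodisation_holds : Lemma1Antiperiodisation` — for every symbol `a ∈ C_c^∞(ℝ × ℝ²)`, every
`T > 0` and every `x`, `(T/(2π)²) Σ_n ∫d²k e^{ikx} a((2n+1)πT, k⃗) = Σ_m (−1)^m C₀[a](x₀ + m/T, x⃗)`.

THE ARGUMENT.  The printed one-line proof («f̂(k) = Ĉ(k) for all Matsubara k», i.e. the Fourier coefficients of the
two `1/T`-antiperiodic functions agree) is the POISSON SUMMATION FORMULA in the time-frequency variable; we follow it
in the form Mathlib provides (`Real.tsum_eq_tsum_fourier_of_rpow_decay`, Σ_n f(n) = Σ_m 𝓕f(m)): with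
`g(k₀) = ∫d²k e^{i(−k₀x₀ + k⃗x⃗)} a(k₀,k⃗)` and `f(y) = g(2πTy + πT)` the left side is `(T/(2π)²) Σ_n f(n)` (the odd
frequencies `(2n+1)πT = 2πT·n + πT`), and `𝓕f(m) = ∫ f(y)e^{−2πimy}dy = ((−1)^m/(2πT)) ∫d³k e^{i(−k₀(x₀+m/T) + k⃗x⃗)} a(k)`
by the substitution `k₀ = 2πTy + πT` (the phase `e^{iπm} = (−1)^m` is the printed sign) and Fubini, i.e.
`(T/(2π)²)·𝓕f(m) = (−1)^m C₀[a](x₀ + m/T, x⃗)`.  The hypotheses of Poisson summation: `f` is `C²` with compact support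
(differentiation under the `d²k` integral twice, Mathlib `hasDerivAt_integral_of_dominated_loc_of_deriv_le`, on the
compact tube containing the support), hence `f = O(|y|^{−2})` trivially and `𝓕f(ξ) = 𝓕(f'')(ξ)/(2πiξ)² = O(|ξ|^{−2})`
(`Real.fourier_iteratedDeriv` and `‖𝓕h‖_∞ ≤ ‖h‖₁`).  No definitions; all helpers are `private`.
-/

noncomputable section

open MeasureTheory Set Filter Asymptotics
open scoped Topology BigOperators FourierTransform

namespace Literature.MathematicalPhysics.QuantumLattice.FermiRG.DR2000

open Literature.MathematicalPhysics.QuantumLattice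

/-! ## Slices of compactly supported functions on `Mom = ℝ × ℝ²` -/

/-- [folklore] -/
private theorem eq_zero_of_lt_norm {Ψ : Mom → ℂ} {R : ℝ} (hR : tsupport Ψ ⊆ Metric.closedBall 0 R)
    {k : Mom} (hk : R < ‖k‖) : Ψ k = 0 :=
  image_eq_zero_of_notMem_tsupport fun h => by
    have := hR h
    rw [Metric.mem_closedBall, dist_zero_right] at this
    linarith

/-- [folklore] -/
private theorem eq_zero_of_lt_norm_snd {Ψ : Mom → ℂ} {R : ℝ} (hR : tsupport Ψ ⊆ Metric.closedBall 0 R) (t : ℝ)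
    {y : Fin 2 → ℝ} (hy : R < ‖y‖) : Ψ (t, y) = 0 :=
  eq_zero_of_lt_norm hR (hy.trans_le (norm_snd_le (t, y)))

/-- [folklore] -/
private theorem eq_zero_of_lt_abs_fst {Ψ : Mom → ℂ} {R : ℝ} (hR : tsupport Ψ ⊆ Metric.closedBall 0 R) {t : ℝ}
    (ht : R < |t|) (y : Fin 2 → ℝ) : Ψ (t, y) = 0 :=
  eq_zero_of_lt_norm hR (ht.trans_le (by rw [← Real.norm_eq_abs]; exact norm_fst_le (t, y)))

/-- [folklore] -/
private theorem integral_eq_setIntegral_closedBall {Ψ : Mom → ℂ} {R : ℝ}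
    (hR : tsupport Ψ ⊆ Metric.closedBall 0 R) (t : ℝ) :
    ∫ y, Ψ (t, y) = ∫ y in Metric.closedBall (0 : Fin 2 → ℝ) R, Ψ (t, y) :=
  (setIntegral_eq_integral_of_forall_compl_eq_zero fun y hy =>
    eq_zero_of_lt_norm_snd hR t (by rwa [Metric.mem_closedBall, dist_zero_right, not_le] at hy)).symm

/-- The integral of a slice of a continuous compactly supported function is continuous in the slice parameter.
[folklore] -/
private theorem continuous_integral_slice {Ψ : Mom → ℂ} {R : ℝ} (hΨ : Continuous Ψ)
    (hR : tsupport Ψ ⊆ Metric.closedBall 0 R) : Continuous fun t : ℝ => ∫ y, Ψ (t, y) := by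
  have h1 : (fun t : ℝ => ∫ y, Ψ (t, y)) = fun t => ∫ y in Metric.closedBall (0 : Fin 2 → ℝ) R, Ψ (t, y) :=
    funext fun t => integral_eq_setIntegral_closedBall hR t
  rw [h1]
  have h2 : Continuous (Function.uncurry fun (t : ℝ) (y : Fin 2 → ℝ) => Ψ (t, y)) :=
    hΨ.comp (continuous_fst.prodMk continuous_snd)
  exact continuous_parametric_integral_of_continuous h2 (isCompact_closedBall (0 : Fin 2 → ℝ) R)

/-- The tube containing the support also contains the support of the `k₀`-derivative. [folklore] -/
private theorem tsupport_fderiv_fst_subset {Ψ : Mom → ℂ} {R : ℝ} (hR : tsupport Ψ ⊆ Metric.closedBall 0 R) :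
    tsupport (fun k : Mom => fderiv ℝ Ψ k (1, 0)) ⊆ Metric.closedBall 0 R :=
  (tsupport_fderiv_apply_subset ℝ ((1 : ℝ), (0 : Fin 2 → ℝ))).trans hR

/-- Differentiation under the `d²k` integral: for a `C¹` compactly supported `Ψ`,
`d/dt ∫ Ψ(t, y) dy = ∫ ∂₀Ψ(t, y) dy`. [folklore] -/
private theorem hasDerivAt_integral_slice {Ψ : Mom → ℂ} {R : ℝ} (hΨ : ContDiff ℝ 1 Ψ)
    (hΨc : HasCompactSupport Ψ) (hR : tsupport Ψ ⊆ Metric.closedBall 0 R) (t₀ : ℝ) :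
    HasDerivAt (fun t : ℝ => ∫ y, Ψ (t, y)) (∫ y, fderiv ℝ Ψ (t₀, y) (1, 0)) t₀ := by
  set K : Set (Fin 2 → ℝ) := Metric.closedBall (0 : Fin 2 → ℝ) R with hK
  have hR' := tsupport_fderiv_fst_subset hR
  have h1 : (fun t : ℝ => ∫ y, Ψ (t, y)) = fun t => ∫ y in K, Ψ (t, y) :=
    funext fun t => integral_eq_setIntegral_closedBall hR t
  have h2 : ∫ y, fderiv ℝ Ψ (t₀, y) (1, 0) = ∫ y in K, fderiv ℝ Ψ (t₀, y) (1, 0) :=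
    integral_eq_setIntegral_closedBall (Ψ := fun k : Mom => fderiv ℝ Ψ k (1, 0)) hR' t₀
  rw [h1, h2]
  have hcont : Continuous Ψ := hΨ.continuous
  have hdcont : Continuous fun k : Mom => fderiv ℝ Ψ k (1, 0) :=
    (hΨ.continuous_fderiv one_ne_zero).clm_apply continuous_const
  obtain ⟨B, hB⟩ := hdcont.bounded_above_of_compact_support (hΨc.fderiv_apply (𝕜 := ℝ) (1, 0))
  haveI : IsFiniteMeasure ((volume : Measure (Fin 2 → ℝ)).restrict K) :=
    ⟨by rw [Measure.restrict_apply_univ]; exact measure_closedBall_lt_top⟩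
  have hslice : ∀ t : ℝ, Continuous fun y : Fin 2 → ℝ => Ψ (t, y) := fun t =>
    hcont.comp (continuous_const.prodMk continuous_id)
  have hdslice : ∀ t : ℝ, Continuous fun y : Fin 2 → ℝ => fderiv ℝ Ψ (t, y) (1, 0) := fun t =>
    hdcont.comp (continuous_const.prodMk continuous_id)
  refine (hasDerivAt_integral_of_dominated_loc_of_deriv_le (μ := (volume : Measure (Fin 2 → ℝ)).restrict K)
    (F := fun (t : ℝ) (y : Fin 2 → ℝ) => Ψ (t, y)) (F' := fun (t : ℝ) (y : Fin 2 → ℝ) => fderiv ℝ Ψ (t, y) (1, 0))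
    (x₀ := t₀) (s := univ) (bound := fun _ => B) Filter.univ_mem ?_ ?_ ?_ ?_ ?_ ?_).2
  · exact Filter.Eventually.of_forall fun t => (hslice t).aestronglyMeasurable
  · exact (hslice t₀).continuousOn.integrableOn_compact (isCompact_closedBall _ _)
  · exact (hdslice t₀).aestronglyMeasurable
  · exact Filter.Eventually.of_forall fun y t _ => hB (t, y)
  · exact integrable_const B
  · refine Filter.Eventually.of_forall fun y t _ => ?_
    have hd : HasFDerivAt Ψ (fderiv ℝ Ψ (t, y)) (t, y) := (hΨ.differentiable one_ne_zero (t, y)).hasFDerivAt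
    have hc : HasDerivAt (fun s : ℝ => ((s, y) : Mom)) ((1 : ℝ), (0 : Fin 2 → ℝ)) t :=
      (hasDerivAt_id t).prodMk (hasDerivAt_const t y)
    exact hd.comp_hasDerivAt t hc

/-- Iterated derivatives of a compactly supported function are compactly supported. [folklore] -/
private theorem hasCompactSupport_iteratedDeriv {f : ℝ → ℂ} (hf : HasCompactSupport f) (n : ℕ) :
    HasCompactSupport (iteratedDeriv n f) := by
  induction n with
  | zero => simpa using hf
  | succ n ih => rw [iteratedDeriv_succ]; exact ih.deriv

/-- `{y : R < |y|}` is co-compact in `ℝ`. [folklore] -/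
private theorem eventually_lt_abs_cocompact (R : ℝ) : ∀ᶠ y : ℝ in cocompact ℝ, R < |y| := by
  rw [cocompact_eq_atBot_atTop, Filter.eventually_sup]
  constructor
  · filter_upwards [eventually_lt_atBot (-R)] with y hy
    have : R < -y := by linarith
    exact this.trans_le (neg_le_abs y)
  · filter_upwards [eventually_gt_atTop R] with y hy
    exact hy.trans_le (le_abs_self y)

/-- `‖𝓕 h(ξ)‖ ≤ ‖h‖₁`. [folklore] -/
private theorem norm_fourier_le_integral_norm (h : ℝ → ℂ) (ξ : ℝ) : ‖𝓕 h ξ‖ ≤ ∫ v, ‖h v‖ := by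
  rw [Real.fourier_real_eq]
  refine (norm_integral_le_integral_norm _).trans (le_of_eq ?_)
  simp_rw [Circle.norm_smul]

/-- A `C²` compactly supported function has `𝓕 f = O(|ξ|⁻²)`. [folklore] -/
private theorem fourier_isBigO_of_contDiff_two {f : ℝ → ℂ} (hf : ContDiff ℝ 2 f) (hfc : HasCompactSupport f) :
    𝓕 f =O[cocompact ℝ] fun x : ℝ => |x| ^ (-(2 : ℝ)) := by
  have hint : ∀ n : ℕ, (n : ℕ∞) ≤ 2 → Integrable (iteratedDeriv n f) := fun n hn =>
    (hf.continuous_iteratedDeriv n (by exact_mod_cast hn)).integrable_of_hasCompactSupport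
      (hasCompactSupport_iteratedDeriv hfc n)
  have hF2 := Real.fourier_iteratedDeriv (N := 2) (n := 2) (by exact_mod_cast hf) hint le_rfl
  set C : ℝ := ∫ y, ‖iteratedDeriv 2 f y‖ with hC
  refine IsBigO.of_bound (C / (4 * Real.pi ^ 2)) ?_
  filter_upwards [eventually_lt_abs_cocompact 1] with ξ hξ
  have hξ0 : ξ ≠ 0 := fun h => by rw [h, abs_zero] at hξ; linarith
  have h1 : ‖𝓕 (iteratedDeriv 2 f) ξ‖ ≤ C := norm_fourier_le_integral_norm _ _
  have h2 : 𝓕 (iteratedDeriv 2 f) ξ = (2 * Real.pi * Complex.I * ξ) ^ 2 • 𝓕 f ξ := congrFun hF2 ξ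
  rw [h2, norm_smul, norm_pow] at h1
  have h3 : ‖(2 * Real.pi * Complex.I * ξ : ℂ)‖ = 2 * Real.pi * |ξ| := by
    simp [Complex.norm_real, abs_of_pos Real.pi_pos]
  rw [h3] at h1
  have hpos : 0 < (2 * Real.pi * |ξ|) ^ 2 := by positivity
  have h4 : ‖𝓕 f ξ‖ ≤ C / (2 * Real.pi * |ξ|) ^ 2 := by
    rw [le_div_iff₀ hpos]; linarith [h1]
  have h5 : ‖(fun x : ℝ => |x| ^ (-(2 : ℝ))) ξ‖ = (|ξ| ^ 2)⁻¹ := by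
    simp only [Real.norm_eq_abs]
    rw [Real.rpow_neg (abs_nonneg ξ), abs_of_nonneg (inv_nonneg.2 (by positivity))]
    norm_num
  rw [h5]
  calc ‖𝓕 f ξ‖ ≤ C / (2 * Real.pi * |ξ|) ^ 2 := h4
    _ = C / (4 * Real.pi ^ 2) * (|ξ| ^ 2)⁻¹ := by field_simp; ring

/-! ## The discharge -/

/-- **DR 2000 Part I, Lemma 1 — PROVED** (discharge of the named fact `Lemma1Antiperiodisation`, cell F-039): for every
smooth compactly supported symbol `a` on `ℝ × ℝ²`, every `T > 0` and every `x = (x₀, x⃗)`,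
`(T/(2π)²) Σ_n ∫d²k e^{ikx} a((2n+1)πT, k⃗) = Σ_{m∈ℤ} (−1)^m C₀[a](x₀ + m/T, x⃗)`, `C₀[a] = (2π)^{−3}∫d³k e^{ikx}a(k)`
(«C(x) = Σ_{m∈ℤ}(−1)^m C₀(x₀ + m/T, x⃗)»).  Proof = the printed «f̂(k) = Ĉ(k) ∀k» made quantitative as Poisson
summation in the frequency variable; see the module docstring.
[cite: DisertoriRivasseau2000, §II.1 Lemma 1 (II.9) p0003:L103–114] -/
theorem Lemma1Antiperiodisation_holds : Lemma1Antiperiodisation := by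
  intro a ha hac T hT x
  have hπ : 0 < Real.pi := Real.pi_pos
  have hT' : (T : ℂ) ≠ 0 := by exact_mod_cast hT.ne'
  have hπ' : (Real.pi : ℂ) ≠ 0 := by exact_mod_cast hπ.ne'
  -- the symbol with its phase, `Φ(k) = e^{ikx} a(k)`
  set Φ : Mom → ℂ := fun k => Complex.exp ((pairing k x : ℂ) * Complex.I) * a k with hΦdef
  have hpair : ContDiff ℝ ((⊤ : ℕ∞) : WithTop ℕ∞) fun k : Mom => (pairing k x : ℂ) := by
    have h0 : ContDiff ℝ ((⊤ : ℕ∞) : WithTop ℕ∞) fun k : Mom => pairing k x := by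
      unfold pairing
      have h2 : ∀ i : Fin 2, ContDiff ℝ ((⊤ : ℕ∞) : WithTop ℕ∞) fun k : Mom => k.2 i := fun i =>
        contDiff_pi.1 contDiff_snd i
      exact ((contDiff_fst.mul contDiff_const).neg).add
        (((h2 0).mul contDiff_const).add ((h2 1).mul contDiff_const))
    exact Complex.ofRealCLM.contDiff.comp h0
  have hΦ : ContDiff ℝ ((⊤ : ℕ∞) : WithTop ℕ∞) Φ :=
    (Complex.contDiff_exp.comp (hpair.mul contDiff_const)).mul ha
  have hΦc : HasCompactSupport Φ := hac.mul_left
  obtain ⟨R, hR⟩ : ∃ R : ℝ, tsupport Φ ⊆ Metric.closedBall 0 R :=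
    hΦc.isCompact.isBounded.subset_closedBall 0
  -- the two `k₀`-derivatives of the symbol
  set Φ₁ : Mom → ℂ := fun k => fderiv ℝ Φ k (1, 0) with hΦ₁def
  set Φ₂ : Mom → ℂ := fun k => fderiv ℝ Φ₁ k (1, 0) with hΦ₂def
  have h1top : (1 : WithTop ℕ∞) ≤ ((⊤ : ℕ∞) : WithTop ℕ∞) := by exact_mod_cast (le_top : (1 : ℕ∞) ≤ ⊤)
  have h2top : (2 : WithTop ℕ∞) ≤ ((⊤ : ℕ∞) : WithTop ℕ∞) := by
    rw [← WithTop.coe_ofNat]; exact WithTop.coe_le_coe.2 le_top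
  have hΦ1 : ContDiff ℝ 1 Φ := hΦ.of_le h1top
  have hΦ2 : ContDiff ℝ 2 Φ := hΦ.of_le h2top
  have hΦ₁1 : ContDiff ℝ 1 Φ₁ := (hΦ2.fderiv_right (m := 1) (by norm_num)).clm_apply contDiff_const
  have hΦ₁c : HasCompactSupport Φ₁ := hΦc.fderiv_apply (𝕜 := ℝ) (1, 0)
  have hR₁ : tsupport Φ₁ ⊆ Metric.closedBall 0 R := tsupport_fderiv_fst_subset hR
  have hR₂ : tsupport Φ₂ ⊆ Metric.closedBall 0 R := tsupport_fderiv_fst_subset hR₁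
  have hΦ₂cont : Continuous Φ₂ := (hΦ₁1.continuous_fderiv one_ne_zero).clm_apply continuous_const
  -- the `d²k`-integrated symbol `g` and its derivatives
  set g : ℝ → ℂ := fun t => ∫ y, Φ (t, y) with hgdef
  set g₁ : ℝ → ℂ := fun t => ∫ y, Φ₁ (t, y) with hg₁def
  set g₂ : ℝ → ℂ := fun t => ∫ y, Φ₂ (t, y) with hg₂def
  have hg : ∀ t, HasDerivAt g (g₁ t) t := fun t => hasDerivAt_integral_slice hΦ1 hΦc hR t
  have hg₁ : ∀ t, HasDerivAt g₁ (g₂ t) t := fun t => hasDerivAt_integral_slice hΦ₁1 hΦ₁c hR₁ t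
  have hg₂ : Continuous g₂ := continuous_integral_slice hΦ₂cont hR₂
  have hdg : deriv g = g₁ := funext fun t => (hg t).deriv
  have hdg₁ : deriv g₁ = g₂ := funext fun t => (hg₁ t).deriv
  have hgC1' : ContDiff ℝ 1 g₁ :=
    contDiff_one_iff_deriv.2 ⟨fun t => (hg₁ t).differentiableAt, by rw [hdg₁]; exact hg₂⟩
  have hgC2 : ContDiff ℝ 2 g := by
    have : ContDiff ℝ ((1 : WithTop ℕ∞) + 1) g :=
      contDiff_succ_iff_deriv.2 ⟨fun t => (hg t).differentiableAt, fun h => by simp at h, by rw [hdg]; exact hgC1'⟩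
    rwa [one_add_one_eq_two] at this
  have hg0 : ∀ t : ℝ, R < |t| → g t = 0 := fun t ht => by
    simp only [hgdef, eq_zero_of_lt_abs_fst hR ht, integral_zero]
  -- `f(y) = g(2πTy + πT)`
  set c : ℝ := 2 * Real.pi * T with hcdef
  have hc : 0 < c := by positivity
  set f : ℝ → ℂ := fun y => g (c * y + Real.pi * T) with hfdef
  have hfC2 : ContDiff ℝ 2 f := hgC2.comp ((contDiff_const.mul contDiff_id).add contDiff_const)
  set R₁ : ℝ := (|R| + Real.pi * T) / c with hR₁def
  have hf0 : ∀ y : ℝ, R₁ < |y| → f y = 0 := fun y hy => by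
    apply hg0
    have h1 : |R| + Real.pi * T < c * |y| := by
      have := (div_lt_iff₀ hc).1 (hR₁def ▸ hy)
      linarith [mul_comm (|y|) c]
    have h2 : c * |y| - Real.pi * T ≤ |c * y + Real.pi * T| := by
      have := abs_sub_abs_le_abs_sub (c * y) (-(Real.pi * T))
      rw [abs_mul, abs_of_pos hc, abs_neg, abs_of_pos (by positivity : 0 < Real.pi * T), sub_neg_eq_add] at this
      linarith
    linarith [le_abs_self R]
  have hfc : HasCompactSupport f := by
    refine HasCompactSupport.intro (isCompact_Icc : IsCompact (Icc (-R₁) R₁)) fun y hy => hf0 y ?_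
    rw [mem_Icc, not_and_or, not_le, not_le] at hy
    rcases hy with hy | hy
    · exact (show R₁ < -y by linarith).trans_le (neg_le_abs y)
    · exact hy.trans_le (le_abs_self y)
  -- Poisson summation for `f`
  have hf_cont : Continuous f := hfC2.continuous
  have hf_O : f =O[cocompact ℝ] fun x : ℝ => |x| ^ (-(2 : ℝ)) := by
    refine IsBigO.of_bound 0 ?_
    filter_upwards [eventually_lt_abs_cocompact R₁] with y hy
    rw [hf0 y hy, norm_zero, zero_mul]
  have hFf_O := fourier_isBigO_of_contDiff_two hfC2 hfc
  have hP := Real.tsum_eq_tsum_fourier_of_rpow_decay hf_cont one_lt_two hf_O hFf_O 0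
  simp only [zero_add, QuotientAddGroup.mk_zero, fourier_eval_zero, mul_one] at hP
  -- the left-hand side is `(T/(2π)²) Σ_n f(n)`
  have hmom : ∀ (n : ℤ) (k : Fin 2 → ℝ), matsubaraMom T n k = (c * n + Real.pi * T, k) := fun n k =>
    Prod.ext (by rw [matsubaraMom_fst, hcdef]; ring) rfl
  have hterm : ∀ n : ℤ, (∫ k : Fin 2 → ℝ, Complex.exp ((pairing (matsubaraMom T n k) x : ℂ) * Complex.I) *
      a (matsubaraMom T n k)) = f n := fun n => by
    simp only [hmom]
    rfl
  have hL : thermalKernel T a x = ((T / (2 * Real.pi) ^ 2 : ℝ) : ℂ) * ∑' n : ℤ, f n := by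
    unfold thermalKernel
    simp_rw [hterm]
  -- the Fourier coefficients of `f` are the zero-temperature kernels
  have hF : ∀ m : ℤ, ((T / (2 * Real.pi) ^ 2 : ℝ) : ℂ) * 𝓕 f m =
      (-1 : ℂ) ^ m * zeroKernel a (x.1 + (m : ℝ) / T, x.2) := by
    intro m
    -- the integrand of `𝓕 f m` as a function of `k₀ = c y + πT`
    set H : ℝ → ℂ := fun k₀ => Complex.exp (-(Complex.I * m * (k₀ - Real.pi * T) / T)) * g k₀ with hHdef
    have hAB : ∀ v : ℝ, ((-2 * Real.pi * v * (m : ℝ) : ℝ) : ℂ) * Complex.I =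
        -(Complex.I * m * (((c * v + Real.pi * T : ℝ) : ℂ) - Real.pi * T) / T) := fun v => by
      rw [hcdef]
      push_cast
      field_simp
      ring
    have hstep1 : 𝓕 f m = ∫ y : ℝ, H (c * y + Real.pi * T) := by
      rw [Real.fourier_real_eq_integral_exp_smul]
      refine integral_congr_ae (Filter.Eventually.of_forall fun v => ?_)
      simp only [hHdef, hfdef]
      rw [smul_eq_mul, hAB v]
    have hstep2 : ∫ y : ℝ, H (c * y + Real.pi * T) = (c⁻¹ : ℝ) • ∫ k₀ : ℝ, H k₀ := by
      have h1 := Measure.integral_comp_mul_left (fun z : ℝ => H (z + Real.pi * T)) c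
      rw [h1, abs_of_pos (inv_pos.2 hc), integral_add_right_eq_self (fun z : ℝ => H z) (Real.pi * T)]
    -- Fubini: `∫ H = (−1)^m ∫d³k e^{ik·(x₀ + m/T, x⃗)} a(k)`
    set G : Mom → ℂ := fun k =>
      Complex.exp (-(Complex.I * m * ((k.1 : ℂ) - Real.pi * T) / T)) * Φ k with hGdef
    have hGcont : Continuous G := by
      refine Continuous.mul ?_ hΦ.continuous
      refine Complex.continuous_exp.comp (Continuous.neg ?_)
      refine Continuous.div_const (Continuous.mul continuous_const ?_) _
      exact (Complex.continuous_ofReal.comp continuous_fst).sub continuous_const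
    have hGc : HasCompactSupport G := hΦc.mul_left
    have hGint : Integrable G := hGcont.integrable_of_hasCompactSupport hGc
    have hstep3 : ∫ k₀ : ℝ, H k₀ = ∫ k : Mom, G k := by
      rw [Measure.volume_eq_prod, integral_prod G hGint]
      refine integral_congr_ae (Filter.Eventually.of_forall fun k₀ => ?_)
      simp only [hHdef, hgdef, hGdef, ← integral_const_mul]
    set x' : Mom := (x.1 + (m : ℝ) / T, x.2) with hx'def
    have hm1 : (-1 : ℂ) ^ m = Complex.exp (m * (Real.pi * Complex.I)) := by
      rw [Complex.exp_int_mul, Complex.exp_pi_mul_I]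
    have hexp : ∀ k : Mom, -(Complex.I * m * ((k.1 : ℂ) - Real.pi * T) / T) + (pairing k x : ℂ) * Complex.I =
        m * (Real.pi * Complex.I) + (pairing k x' : ℂ) * Complex.I := fun k => by
      simp only [pairing, hx'def]
      push_cast
      field_simp
      ring
    have hstep4 : ∫ k : Mom, G k =
        (-1 : ℂ) ^ m * ∫ k : Mom, Complex.exp ((pairing k x' : ℂ) * Complex.I) * a k := by
      rw [← integral_const_mul]
      refine integral_congr_ae (Filter.Eventually.of_forall fun k => ?_)
      simp only [hGdef, hΦdef]
      rw [hm1, ← mul_assoc, ← Complex.exp_add, ← mul_assoc, ← Complex.exp_add, hexp k]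
    have hconst : ((T / (2 * Real.pi) ^ 2 : ℝ) : ℂ) * ((c⁻¹ : ℝ) : ℂ) = ((1 / (2 * Real.pi) ^ 3 : ℝ) : ℂ) := by
      rw [← Complex.ofReal_mul]
      congr 1
      rw [hcdef]
      field_simp
    rw [hstep1, hstep2, hstep3, hstep4, Complex.real_smul]
    unfold zeroKernel
    calc ((T / (2 * Real.pi) ^ 2 : ℝ) : ℂ) * (((c⁻¹ : ℝ) : ℂ) *
          ((-1 : ℂ) ^ m * ∫ k : Mom, Complex.exp ((pairing k x' : ℂ) * Complex.I) * a k))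
        = (((T / (2 * Real.pi) ^ 2 : ℝ) : ℂ) * ((c⁻¹ : ℝ) : ℂ)) *
            ((-1 : ℂ) ^ m * ∫ k : Mom, Complex.exp ((pairing k x' : ℂ) * Complex.I) * a k) := by ring
      _ = ((1 / (2 * Real.pi) ^ 3 : ℝ) : ℂ) *
            ((-1 : ℂ) ^ m * ∫ k : Mom, Complex.exp ((pairing k x' : ℂ) * Complex.I) * a k) := by rw [hconst]
      _ = (-1 : ℂ) ^ m * (((1 / (2 * Real.pi) ^ 3 : ℝ) : ℂ) *
            ∫ k : Mom, Complex.exp ((pairing k x' : ℂ) * Complex.I) * a k) := by ring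
  -- assemble
  rw [hL, hP, ← tsum_mul_left]
  exact tsum_congr hF

end Literature.MathematicalPhysics.QuantumLattice.FermiRG.DR2000

end
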